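import Literature.NumberTheory.EllipticCurves.Kato2004.LocalIwasawaCohomologyPoitouTateProofs

set_option linter.dupNamespace false

/-!
# Cert48 — crux-triage r1 seat 1, GEN 48: kernel pre-vet of the KEY STEP of w3 GEN 7's announced split
`V♭⁻ ⟺ G11⁻ ∧ MU13⁻` (HOME STATUS 17:23Z) of the registered memo stub `stub_muFreeValue_negDisc_two` (v24 4921f2ec).

Abstract, cone-free, every `p`: over `Λ = IwasawaAlgebra p`, for a `Λ`-module `H` (read: `𝐇¹_Γ(T_pW)`), an element `z : H`
(read: the GENUINE Euler-system / zeta class) with `H ⧸ Λ∙z` finitely generated over `ℤ_p` (read: MU13⁻, «μ(𝐇¹_Γ/Λz) = 0»), and a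
`Λ`-linear functional `f : H → Λ` (read: `col ∘ loc₂`, the (p)-normalised ordinary-kernel functional composed with localisation),
a value `f y ∉ (p)` on SOME class `y` (read: what G11⁻ + PUB-torsion + Poitou–Tate exactness give through p733613's
`exists_notMem_col_loc_of_poitouTate_of_moduleFinite`) forces `f z ∉ (p)` on the genuine class `z` (read: V♭⁻'s value clause).
The proof is ONE application of the tree's X-monic lemma `mem_augIdealP_of_addMonoidHom_of_moduleFinite` (p733613, Washington §13.2)
to the quotient map `H → H ⧸ Λ∙z`, plus primality of `(p)` only implicitly (inside that lemma).

So the (⇐) half of the split is KERNEL modulo {p729889 (PT-exact), PUB (torsion), p733613}; the (⇒) half is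
V♭⁻ ⇒ F1μι⁻ ⇒ μ(X) = 0 (= G11⁻, landed road p727801 → p720644 → `mu_eq_zero_of_iotaNegDisc`) and V♭⁻ ⇒ MU13⁻ (needs `f` injective on
`H`: torsion-free rank-one `𝐇¹_Γ`, Kato 12.4, + Λ/(g) f.g./ℤ_p for g ∉ (p) — Weierstrass; not certified here).
COROLLARY (third theorem): under MU13 and one μ-free value, `z ∉ (p)•H` — at `p = 2` this is the span clause `s ∉ augIdealP 2 • ⊤`
(«genuine class not 2-divisible in 𝐇¹_Γ») of the tree's socket 1 `CoreTheoremATwoResidue`, PROVED on `Δ < 0` (p669276); so on the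
Δ<0 onto cell MU13⁻ feeds socket 1 and hence μ(X_fine) = 0 (the Y-summand of G11⁻) — inside the pair {G11⁻, MU13⁻} only G11⁻'s
coarse summand μ(C⁻) = 0 is independent information.
BSD is not proved by any of this; nothing here touches a registered stub's text.
-/

namespace Summit.BirchSwinnertonDyer.BirchSwinnertonDyer.Cruxes.OrdKatoHalfAtTwoIso.TriageCert48

open Literature.NumberTheory.EllipticCurves Literature.NumberTheory.EllipticCurves.Kato2004

variable {p : ℕ} [Fact p.Prime]

/-- **MU13 + one μ-free value ⟹ the μ-free value on the genuine class.** If `H ⧸ Λ∙z` is finitely generated over `ℤ_p` and a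
`Λ`-linear `f : H → Λ` takes a value outside `(p)` somewhere, then `f z ∉ (p)`. [folklore; Washington §13.2 via p733613] -/
theorem notMem_augIdealP_of_moduleFinite_quotient_span
    {H : Type*} [AddCommGroup H] [Module (IwasawaAlgebra p) H] (z : H)
    (hfin : Module.Finite ℤ_[p]
      (RestrictScalars ℤ_[p] (IwasawaAlgebra p) (H ⧸ Submodule.span (IwasawaAlgebra p) ({z} : Set H))))
    (f : H →ₗ[IwasawaAlgebra p] IwasawaAlgebra p) (y : H) (hy : f y ∉ IwasawaAlgebra.augIdealP p) :
    f z ∉ IwasawaAlgebra.augIdealP p := by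
  intro hz
  apply hy
  refine mem_augIdealP_of_addMonoidHom_of_moduleFinite hfin
    ((Submodule.span (IwasawaAlgebra p) ({z} : Set H)).mkQ.toAddMonoidHom) ?_ f ?_ y
  · intro c x
    exact (Submodule.span (IwasawaAlgebra p) ({z} : Set H)).mkQ.map_smul (PowerSeries.C c) x
  · intro x hx
    have hx' : x ∈ Submodule.span (IwasawaAlgebra p) ({z} : Set H) := by
      simpa [Submodule.mkQ_apply, Submodule.Quotient.mk_eq_zero] using hx
    obtain ⟨a, rfl⟩ := Submodule.mem_span_singleton.mp hx'
    rw [map_smul, smul_eq_mul]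
    exact Ideal.mul_mem_left _ a hz

/-- The same, phrased as the announced door shape: «MU13 ∧ (∃ y, f y ∉ (p)) → f z ∉ (p)». -/
theorem valueClause_of_MU13_of_exists_value
    {H : Type*} [AddCommGroup H] [Module (IwasawaAlgebra p) H] (z : H)
    (hMU13 : Module.Finite ℤ_[p]
      (RestrictScalars ℤ_[p] (IwasawaAlgebra p) (H ⧸ Submodule.span (IwasawaAlgebra p) ({z} : Set H))))
    (f : H →ₗ[IwasawaAlgebra p] IwasawaAlgebra p) (hval : ∃ y : H, f y ∉ IwasawaAlgebra.augIdealP p) :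
    f z ∉ IwasawaAlgebra.augIdealP p := by
  obtain ⟨y, hy⟩ := hval
  exact notMem_augIdealP_of_moduleFinite_quotient_span z hMU13 f y hy

/-- Converse bookkeeping (trivial half of «lossless»): if `f z ∉ (p)` then of course some class has a μ-free value. -/
theorem exists_value_of_valueClause
    {H : Type*} [AddCommGroup H] [Module (IwasawaAlgebra p) H] (z : H)
    (f : H →ₗ[IwasawaAlgebra p] IwasawaAlgebra p) (hz : f z ∉ IwasawaAlgebra.augIdealP p) :
    ∃ y : H, f y ∉ IwasawaAlgebra.augIdealP p := ⟨z, hz⟩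

/-- **MU13 + one μ-free value ⟹ socket 1's divisibility hypothesis «`z ∉ p·H`».** A `Λ`-linear functional maps `(p)•H`
into `(p)`, so under MU13 the genuine class `z` cannot lie in `(p)•H` (read at `p = 2`: `z ∉ 2·𝐇¹_Γ`, the span clause
`s ∉ augIdealP 2 • ⊤` of the tree's socket 1 `CoreTheoremATwoResidue`, a THEOREM on `Δ < 0`, p669276). [folklore] -/
theorem notMem_augIdealP_smul_top_of_MU13_of_exists_value
    {H : Type*} [AddCommGroup H] [Module (IwasawaAlgebra p) H] (z : H)
    (hMU13 : Module.Finite ℤ_[p]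
      (RestrictScalars ℤ_[p] (IwasawaAlgebra p) (H ⧸ Submodule.span (IwasawaAlgebra p) ({z} : Set H))))
    (f : H →ₗ[IwasawaAlgebra p] IwasawaAlgebra p) (hval : ∃ y : H, f y ∉ IwasawaAlgebra.augIdealP p) :
    z ∉ IwasawaAlgebra.augIdealP p • (⊤ : Submodule (IwasawaAlgebra p) H) := by
  intro hz
  apply valueClause_of_MU13_of_exists_value z hMU13 f hval
  have h1 : f z ∈ (IwasawaAlgebra.augIdealP p • (⊤ : Submodule (IwasawaAlgebra p) H)).map f :=
    Submodule.mem_map_of_mem hz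
  rw [Submodule.map_smul''] at h1
  refine (Submodule.smul_le.mpr ?_) h1
  intro r hr n _
  rw [smul_eq_mul]
  exact Ideal.mul_mem_right n _ hr

end Summit.BirchSwinnertonDyer.BirchSwinnertonDyer.Cruxes.OrdKatoHalfAtTwoIso.TriageCert48
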